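import Summits.ResolutionOfSingularities.ResolutionOfSingularities.Theorems.MarkedTransferCampaignW46FiniteExitBoundQuadratic
import Literature.AlgebraicGeometry.Resolution.ColonIdealSheafFG
import HarnessLib

/-!
# [OURS · L1 W4.6 rung (i-a)′] Dictionary, part 3: the stalk of the TRANSFORM at a point over the centre is the
# controlled transform `(J S : (𝔪 S)^b)` of the germ, and distinct points over the centre have distinct local rings in
# `K(Z)` (cell res-hironaka, LADDER-RESOLUTION rung L, D-0089; campaign s46, seat res-D-pv-046 AS res-L1-s46-pv-9; host
# route MarkedTransfer, `--supports stmt-ResolutionOfSingularities-16156 --as helper`)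

HONEST FRAMING. Nothing here is a statement of H. Hironaka's manuscript (2017-03-23, [Hironaka2017]) and nothing here
asserts that any statement of it holds. Pure scheme theory over TREE theorems (`ColonIdealSheafFG.lean`: the stalk of the
controlled transform is a colon ideal; `BlowupStalkEmbedding.lean`: the embeddings `ε_{ξ′}` and their `K(Z)`-points;
`BlowupsProperProofs.lean`: blow-ups are proper) and Mathlib (`ext_of_isDominant_of_isSeparated`). AI review is weaker than
expert review. No `sorry`; axioms standard.

## What this file provides (items (D3b)/(D3c) of the dictionary for res-L1-s46-pv-8, HOME/STATUS 2026-08-27T05:03:39Z)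

For a blowing up `π : Z′ → Z` along the reduced ideal of a closed point `ξ` (or along any `J`, where stated) of an integral
locally Noetherian `Z`, `Z′` integral, and points `ξ′` over `ξ`, with `S_{ξ′} := ε_{ξ′}(𝒪_{Z′,ξ′}) ⊆ K(Z)`
(`IsBlowup.fibreSubalgebra`, a quadratic transform of `𝒪_{Z,ξ}` by part 2 p503229):

* `map_colon_eq_of_ringEquiv` — colon ideals under ring isomorphisms (bookkeeping).
* `stalkEquivFibreSubalgebra_stalkMap` — `𝒪_{Z′,ξ′} ≅ S_{ξ′}` sends `π^♯ a` to (the image of) `a ∈ 𝒪_{Z,ξ}`.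
* **`map_stalkIdeal_transform_eq_colon`** — the IDEAL IDENTITY: under `𝒪_{Z′,ξ′} ≅ S_{ξ′}` the stalk at `ξ′` of the
  transform `E′ = E.transform π {ξ}` (Def. 2.1, controlled transform) is `(J_ξ S_{ξ′} : (𝔪_ξ S_{ξ′})^b)` — the algebraic
  controlled transform of the germ `(J_ξ, b)` at the quadratic transform `S_{ξ′}`.
* **`eq_of_fibreSubalgebra_eq`** — INJECTIVITY: two points of `Z′` (over the same point) with the same local ring inside
  `K(Z)` coincide (the two `Spec 𝒪 → Z′` agree over `Z` and at the generic point; `π` is separated, being proper).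

## References

* The Stacks Project, Tags 0804, 01J7, 01KM (separatedness and uniqueness of extensions). [StacksProject]
* J. Kollár, *Lectures on Resolution of Singularities* (2007), §1.4. [Kollar2007]
* M. Atiyah, I. Macdonald, *Introduction to Commutative Algebra* (1969), Cor. 3.15 (colon ideals localise). [AtiyahMacdonald1969]
-/

noncomputable section

set_option linter.dupNamespace false -- mandated namespace of this single-conjunct summit

open CategoryTheory AlgebraicGeometry TopologicalSpace IsLocalRing

namespace Summit.ResolutionOfSingularities.ResolutionOfSingularities.Theorems

namespace CampaignW46

open Literature.AlgebraicGeometry.Resolution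
open Literature.AlgebraicGeometry.Hironaka2017.S02Preliminaries
open Scheme.IdealSheafData

universe u

/-! ## Colon ideals under ring isomorphisms -/

/-- A ring isomorphism carries a colon ideal onto the colon ideal of the images. [folklore] -/
theorem map_colon_eq_of_ringEquiv {R S : Type*} [CommRing R] [CommRing S] (e : R ≃+* S) (I J : Ideal R) :
    (Submodule.colon I (J : Set R)).map e.toRingHom = Submodule.colon (I.map e.toRingHom) (J.map e.toRingHom : Set S) := by
  ext y
  constructor
  · intro hy
    obtain ⟨x, hx, rfl⟩ := (Ideal.mem_map_iff_of_surjective e.toRingHom e.surjective).mp hy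
    refine Submodule.mem_colon.mpr fun s hs => ?_
    obtain ⟨j, hj, rfl⟩ := (Ideal.mem_map_iff_of_surjective e.toRingHom e.surjective).mp hs
    rw [smul_eq_mul, ← map_mul]
    exact Ideal.mem_map_of_mem _ (by simpa [smul_eq_mul] using Submodule.mem_colon.mp hx j hj)
  · intro hy
    obtain ⟨x, rfl⟩ := e.surjective y
    refine Ideal.mem_map_of_mem e.toRingHom (Submodule.mem_colon.mpr fun j hj => ?_)
    have h1 : e x * e j ∈ I.map e.toRingHom := by
      simpa [smul_eq_mul] using Submodule.mem_colon.mp hy (e j) (Ideal.mem_map_of_mem e.toRingHom hj)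
    rw [← map_mul] at h1
    obtain ⟨i, hi, hfi⟩ := (Ideal.mem_map_iff_of_surjective e.toRingHom e.surjective).mp h1
    rw [smul_eq_mul, ← e.injective hfi]
    exact hi

section FibreDictionary

variable {Z Z' : Scheme.{u}} [IsIntegral Z] [IsIntegral Z'] [IsLocallyNoetherian Z]
  {π : Z' ⟶ Z} {J : Z.IdealSheafData}

/-! ## The isomorphism `𝒪_{Z′,ξ′} ≅ S_{ξ′}` on the image of `𝒪_{Z,ξ}` -/

omit [IsIntegral Z'] in
/-- Under `𝒪_{Z′,ξ′} ≅ S_{ξ′} ⊆ K(Z)`, `π^♯ a` goes to `a` (read in `S_{ξ′}` through the algebra structure of the fibre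
subalgebra). [cite: Kollar2007, §1.4] -/
theorem stalkEquivFibreSubalgebra_stalkMap (hπ : IsBlowup π J) (ξ' : Z') (a : Z.presheaf.stalk (π ξ')) :
    hπ.stalkEquivFibreSubalgebra (π ξ') ξ' rfl ((π.stalkMap ξ').hom a) =
      algebraMap (Z.presheaf.stalk (π ξ')) (hπ.fibreSubalgebra (π ξ') ξ' rfl) a := by
  apply Subtype.ext
  rw [Subalgebra.coe_algebraMap]
  change hπ.stalkEmb ξ' ((π.stalkMap ξ').hom a) = _
  exact hπ.stalkEmb_stalkMap ξ' a

omit [IsIntegral Z'] in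
/-- The same as an identity of ring homomorphisms. [cite: Kollar2007, §1.4] -/
theorem stalkEquivFibreSubalgebra_comp_stalkMap (hπ : IsBlowup π J) (ξ' : Z') :
    (hπ.stalkEquivFibreSubalgebra (π ξ') ξ' rfl).toRingHom.comp (π.stalkMap ξ').hom =
      algebraMap (Z.presheaf.stalk (π ξ')) (hπ.fibreSubalgebra (π ξ') ξ' rfl) :=
  RingHom.ext fun a => stalkEquivFibreSubalgebra_stalkMap hπ ξ' a

/-! ## The stalk of the transform is the controlled transform of the germ -/

omit [IsIntegral Z'] in
/-- **The ideal identity.** For the blowing up `π : Z′ → Z` of the closed point `π ξ′` and an ideal exponent `E = (J, b)`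
on `Z`: under `e : 𝒪_{Z′,ξ′} ≅ S_{ξ′}`, the stalk at `ξ′` of the transform `E′ = E.transform π {π ξ′}` (Def. 2.1: the
controlled transform `(J 𝒪_{Z′} : (𝓘_{ξ} 𝒪_{Z′})^b)`) is the colon ideal `(J_ξ S_{ξ′} : (𝔪_ξ S_{ξ′})^b)` — tree
`IsBlowup.stalkIdeal_controlledTransform` (colon commutes with localisation), `stalkIdeal_comap_eq_map_stalkMap`, and
`𝓘_{{ξ},ξ} = 𝔪_ξ`. [cite: AtiyahMacdonald1969, Cor. 3.15] -/
theorem map_stalkIdeal_transform_eq_colon {ξ' : Z'} (hξ : IsClosed ({π ξ'} : Set Z))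
    (hπ : IsBlowup π (vanishingIdeal ⟨{π ξ'}, hξ⟩)) (E : IdealExponent Z) :
    (stalkIdeal (E.transform π ⟨{π ξ'}, hξ⟩).J ξ').map (hπ.stalkEquivFibreSubalgebra (π ξ') ξ' rfl).toRingHom =
      Submodule.colon ((stalkIdeal E.J (π ξ')).map (algebraMap (Z.presheaf.stalk (π ξ')) (hπ.fibreSubalgebra (π ξ') ξ' rfl)))
        (((maximalIdeal (Z.presheaf.stalk (π ξ'))).map
          (algebraMap (Z.presheaf.stalk (π ξ')) (hπ.fibreSubalgebra (π ξ') ξ' rfl))) ^ E.b :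
            Ideal (hπ.fibreSubalgebra (π ξ') ξ' rfl)) := by
  set e := hπ.stalkEquivFibreSubalgebra (π ξ') ξ' rfl with he
  have hJ' : (E.transform π ⟨{π ξ'}, hξ⟩).J = controlledTransform π (vanishingIdeal ⟨{π ξ'}, hξ⟩) E.J E.b := rfl
  rw [hJ', hπ.stalkIdeal_controlledTransform E.J E.b ξ', map_colon_eq_of_ringEquiv, Ideal.map_pow,
    stalkIdeal_comap_eq_map_stalkMap, stalkIdeal_comap_eq_map_stalkMap,
    stalkIdeal_vanishingIdeal_singleton (X := Z) hξ, Ideal.map_map, Ideal.map_map,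
    stalkEquivFibreSubalgebra_comp_stalkMap hπ ξ']

/-! ## Injectivity: distinct points over the centre have distinct local rings in `K(Z)` -/

/-- **Points of a blowing up with the same local ring inside `K(Z)` coincide.** If `ξ₁`, `ξ₂ ∈ Z′` lie over the same
point `ξ` and `ε_{ξ₁}(𝒪_{Z′,ξ₁}) = ε_{ξ₂}(𝒪_{Z′,ξ₂})` as subalgebras of `K(Z)`, then `ξ₁ = ξ₂`: the two morphisms
`Spec 𝒪_{Z′,ξ₁} → Z′` (through `ξ₁`, and through `ξ₂` via the induced isomorphism of local rings) agree over `Z` and at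
the generic point, so they are equal because `π` is separated (it is proper) and `Spec 𝒪_{Z′,ξ₁}` is reduced (Mathlib
`ext_of_isDominant_of_isSeparated`); evaluate at the closed point. [cite: StacksProject, Tag 01KM] -/
theorem eq_of_fibreSubalgebra_eq (hπ : IsBlowup π J) {ξ : Z} {ξ₁ ξ₂ : Z'} (h₁ : π ξ₁ = ξ) (h₂ : π ξ₂ = ξ)
    (heq : hπ.fibreSubalgebra ξ ξ₁ h₁ = hπ.fibreSubalgebra ξ ξ₂ h₂) : ξ₁ = ξ₂ := by
  haveI : IsProper π := hπ.isProper
  -- the local rings and their embeddings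
  let e₁ := hπ.stalkEquivFibreSubalgebra ξ ξ₁ h₁
  let e₂ := hπ.stalkEquivFibreSubalgebra ξ ξ₂ h₂
  have he₁ : ∀ a, ((e₁ a : hπ.fibreSubalgebra ξ ξ₁ h₁) : Z.functionField) = hπ.stalkEmb ξ₁ a := fun _ => rfl
  have he₂ : ∀ a, ((e₂ a : hπ.fibreSubalgebra ξ ξ₂ h₂) : Z.functionField) = hπ.stalkEmb ξ₂ a := fun _ => rfl
  -- the isomorphism `θ : 𝒪_{Z′,ξ₂} ≅ 𝒪_{Z′,ξ₁}` with `ε₁ ∘ θ = ε₂`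
  let θ : Z'.presheaf.stalk ξ₂ ≃+* Z'.presheaf.stalk ξ₁ :=
    (e₂.trans (Subalgebra.equivOfEq _ _ heq.symm).toRingEquiv).trans e₁.symm
  have hθ : ∀ a, hπ.stalkEmb ξ₁ (θ a) = hπ.stalkEmb ξ₂ a := by
    intro a
    rw [← he₁, ← he₂]
    change ((e₁ (e₁.symm _) : hπ.fibreSubalgebra ξ ξ₁ h₁) : Z.functionField) = _
    rw [e₁.apply_symm_apply]
    rfl
  haveI : IsLocalHom θ.toRingHom := ⟨fun a ha => (MulEquiv.isUnit_map θ).mp ha⟩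
  -- the two morphisms `Spec 𝒪_{Z′,ξ₁} → Z′`
  let f : Spec (Z'.presheaf.stalk ξ₁) ⟶ Z' := Z'.fromSpecStalk ξ₁
  let g : Spec (Z'.presheaf.stalk ξ₁) ⟶ Z' := Spec.map (CommRingCat.ofHom θ.toRingHom) ≫ Z'.fromSpecStalk ξ₂
  -- they agree over `Z`
  have hsp : π ξ₂ ⤳ π ξ₁ := by rw [h₁, h₂]
  have key : (Z.presheaf.stalkSpecializes hsp ≫ π.stalkMap ξ₂) ≫ CommRingCat.ofHom θ.toRingHom = π.stalkMap ξ₁ := by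
    ext a
    apply hπ.stalkEmb_injective ξ₁
    change hπ.stalkEmb ξ₁ (θ ((π.stalkMap ξ₂).hom ((Z.presheaf.stalkSpecializes hsp).hom a))) =
      hπ.stalkEmb ξ₁ ((π.stalkMap ξ₁).hom a)
    rw [hθ, hπ.stalkEmb_stalkMap, hπ.stalkEmb_stalkMap]
    exact RingHom.congr_fun (algebraMap_comp_stalkSpecializes (C := Z) hsp) a
  have hover : f ≫ π = g ≫ π := by
    change Z'.fromSpecStalk ξ₁ ≫ π = (Spec.map (CommRingCat.ofHom θ.toRingHom) ≫ Z'.fromSpecStalk ξ₂) ≫ π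
    rw [Category.assoc] at key
    rw [← Scheme.SpecMap_stalkMap_fromSpecStalk, Category.assoc, ← Scheme.SpecMap_stalkMap_fromSpecStalk,
      ← Scheme.SpecMap_stalkSpecializes_fromSpecStalk hsp, ← Category.assoc, ← Category.assoc, ← Spec.map_comp,
      ← Spec.map_comp]
    exact (congrArg (fun φ => Spec.map φ ≫ Z.fromSpecStalk (π ξ₁)) key).symm
  -- they agree at the generic point
  let ι : Spec Z.functionField ⟶ Spec (Z'.presheaf.stalk ξ₁) := Spec.map (CommRingCat.ofHom (hπ.stalkEmb ξ₁))
  have hgen : ι ≫ f = ι ≫ g := by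
    change Spec.map (CommRingCat.ofHom (hπ.stalkEmb ξ₁)) ≫ Z'.fromSpecStalk ξ₁ =
      Spec.map (CommRingCat.ofHom (hπ.stalkEmb ξ₁)) ≫ (Spec.map (CommRingCat.ofHom θ.toRingHom) ≫ Z'.fromSpecStalk ξ₂)
    rw [← Category.assoc, ← Spec.map_comp]
    have hcomp : CommRingCat.ofHom θ.toRingHom ≫ CommRingCat.ofHom (hπ.stalkEmb ξ₁) = CommRingCat.ofHom (hπ.stalkEmb ξ₂) := by
      ext a
      exact hθ a
    rw [hcomp, hπ.SpecMap_stalkEmb_fromSpecStalk ξ₁, hπ.SpecMap_stalkEmb_fromSpecStalk ξ₂]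
  -- the `K(Z)`-point is dominant in `Spec 𝒪_{Z′,ξ₁}`
  haveI hdomι : IsDominant ι := by
    refine ⟨?_⟩
    have hd : DenseRange (PrimeSpectrum.comap (hπ.stalkEmb ξ₁)) :=
      (PrimeSpectrum.denseRange_comap_iff_ker_le_nilRadical (hπ.stalkEmb ξ₁)).mpr (by
        rw [(RingHom.injective_iff_ker_eq_bot _).mp (hπ.stalkEmb_injective ξ₁)]; exact bot_le)
    exact hd
  have hfg : f = g := ext_of_isDominant_of_isSeparated π hover ι hgen
  -- evaluate at the closed point
  have h1 : f (closedPoint (Z'.presheaf.stalk ξ₁)) = ξ₁ := Scheme.fromSpecStalk_closedPoint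
  have h2 : g (closedPoint (Z'.presheaf.stalk ξ₁)) = ξ₂ := by
    change Z'.fromSpecStalk ξ₂ (Spec.map (CommRingCat.ofHom θ.toRingHom) (closedPoint (Z'.presheaf.stalk ξ₁))) = ξ₂
    rw [Spec_closedPoint, Scheme.fromSpecStalk_closedPoint]
  rw [← h1, ← h2, hfg]

end FibreDictionary

end CampaignW46

end Summit.ResolutionOfSingularities.ResolutionOfSingularities.Theorems

end
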